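import Literature.NumberTheory.ModularForms.LevelOneManinCongruences
import Literature.NumberTheory.ModularForms.LevelOneEisensteinCongruencesWeightTwentyFour
import HarnessLib

/-!
# The weight-24 Eisenstein congruences "in elementary way" (Datskovsky–Guerzhoy, p. 2287)

B. Datskovsky, P. Guerzhoy, *On Ramanujan congruences for modular forms of integral and half-integral weights*,
Proc. Amer. Math. Soc. **124** (1996), end of §1 (p. 2287), verbatim:

> "One can also rewrite these congruences in elementary way, i.e. using only arithmetic functions `τ(n)` and
> `σ_k(n)`:
> `Σ_{n=a+b, a,b≥0} τ(a) ( τ(b)(324204/691 + 264) + (65520/691) σ₁₁(b) ) ≡ σ₂₃(n) mod 103`,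
> and
> `Σ_{n=a+b, a,b≥0} τ(a) ( τ(b)(324204/691 − 791119) + (65520/691) σ₁₁(b) ) ≡ σ₂₃(n) mod 2294797`.
> Here `σ_k(0)` stands for the number `−B_k/2k`."

(The congruences are in the sense of the paper's §1 Definition, `x ≡ y mod N·ℤ_{(N)}` for rationals — the tree's
`RatCongr`; the convention for `σ(0)` is that of the constant term of `G_k = −B_k/2k + Σ σ_{k−1}(n)qⁿ`, i.e.
`(65520/691)σ₁₁(0) = 1` is the constant term of `E₁₂` and `σ₂₃(0) = −B₂₄/48`.)

Everything is PROVED. The left-hand sides are the coefficients of `Δ·(E₁₂ + λΔ)` (`E₁₂ = 1 + (65520/691)Σσ₁₁(n)qⁿ`,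
`Δ² = Σ_{a+b=n} τ(a)τ(b) qⁿ`), and `ΔE₁₂ = ΔE₄³ − (432000/691)Δ²` in `S₂₄` (compare `a₁, a₂`); so the printed sums
equal `c_n + (λ − 432000/691)d_n` with `c_n = [qⁿ]ΔE₄³`, `d_n = [qⁿ]Δ²` (file `LevelOneEisensteinCongruencesWeightTwentyFour`),
and `λ − 432000/691 = 108 ≡ 5 (mod 103)`, resp. `= −791275 ≡ 1503522 (mod 2294797)`, where that file proves
`c_n + 5d_n ≡ σ₂₃(n) (mod 103)` and `c_n + 1503522 d_n ≡ σ₂₃(n) (mod 2294797)` (the reductions of `f₂ ≡ G₂₄`).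
(`324204/691 = 432000/691 − 156` and `264 = −12·(−22)`, `−791119 ≡ −12·1022092`: the printed constants are the
reductions of the coefficient `432000/691 − 156 − 12√144169` of `Δ²` in `f₂ = ΔE₁₂ + (…)Δ²`.)

## Contents

* `levelOneEisensteinGCoeff k n` (`σ_{k−1}(n)` with DG's convention `σ_{k−1}(0) = −B_k/2k`, i.e. the coefficients of `G_k`),
  `ratCast_levelOneEisensteinGCoeff`;
* weight 24: `deltaE₁₂ = Δ·E₁₂ ∈ S₂₄`, `deltaE₁₂_eq_smul_g₁_add_smul_g₂` (`ΔE₁₂ = ΔE₄³ − (432000/691)Δ²`),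
  `d_eq_sum_ramanujanTau` (`[qⁿ]Δ² = Σ τ(a)τ(n−a)`), `elementarySum_eq` (the printed sums `= c_n + (λ − 432000/691)d_n`);
* ★**`ratCongr_elementarySum_oneHundredThree`**, ★**`ratCongr_elementarySum_twoMillion`** — the two displayed
  congruences, for every `n ≥ 0`.

## References

* [DatskovskyGuerzhoy1996] B. Datskovsky, P. Guerzhoy, Proc. AMS 124 (1996), p. 2287 (end of §1).
* [Serre1973] J.-P. Serre, *A Course in Arithmetic*, GTM 7, Ch. VII §4.1 (34) (`G_k`, `E_k`), §4.4 (Δ).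
* [Zagier2008] D. Zagier, in *The 1-2-3 of Modular Forms*, §4.1 (`S₂₄ = ⟨ΔE₄³, Δ²⟩`).
-/

noncomputable section

open scoped MatrixGroups ModularForm
open UpperHalfPlane hiding I
open ArithmeticFunction (sigma sigma_one)

namespace Literature.NumberTheory.ModularForms

/-! ## §1 The coefficients of `G_k` (DG's convention `σ_{k−1}(0) = −B_k/2k`) -/

/-- The `n`-th Fourier coefficient of `G_k = −B_k/2k + Σ_{n≥1} σ_{k−1}(n)qⁿ` as a rational number:
`σ_{k−1}(n)` for `n ≥ 1` and `−B_k/2k` for `n = 0` — Datskovsky–Guerzhoy's convention "`σ(0)` stands for the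
number `−B_k/2k`". [cite: DatskovskyGuerzhoy1996, §1 (definition of `G_k`) and p. 2287 ("Here `σ_k(0)` stands for
the number `−B_k/2k`")] [cite: Serre1973, Ch. VII §4.1 (34)] -/
def levelOneEisensteinGCoeff (k n : ℕ) : ℚ :=
  if n = 0 then -bernoulliRatio k else sigma (k - 1) n

/-- `levelOneEisensteinGCoeff k 0 = −B_k/2k`. [cite: DatskovskyGuerzhoy1996, p. 2287] -/
theorem levelOneEisensteinGCoeff_zero (k : ℕ) : levelOneEisensteinGCoeff k 0 = -bernoulliRatio k :=
  if_pos rfl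

/-- `levelOneEisensteinGCoeff k n = σ_{k−1}(n)` for `n ≥ 1`. [cite: DatskovskyGuerzhoy1996, §1] -/
theorem levelOneEisensteinGCoeff_of_pos (k : ℕ) {n : ℕ} (hn : 0 < n) : levelOneEisensteinGCoeff k n = sigma (k - 1) n :=
  if_neg hn.ne'

/-- `levelOneEisensteinGCoeff k n` is the `n`-th coefficient of the tree's `G_k = levelOneEisensteinG`.
[cite: DatskovskyGuerzhoy1996, §1 ("`G_k = −B_k/2k + Σ σ_{k−1}(n)qⁿ`")] -/
theorem ratCast_levelOneEisensteinGCoeff {k : ℕ} (hk : 3 ≤ k) (hk2 : Even k) (n : ℕ) :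
    ((levelOneEisensteinGCoeff k n : ℚ) : ℂ) = (qExpansion 1 ⇑(levelOneEisensteinG hk)).coeff n := by
  rw [qExpansion_coeff_levelOneEisensteinG hk hk2, levelOneEisensteinGCoeff]
  split_ifs
  · rfl
  · exact Rat.cast_natCast _

namespace WeightTwentyFour

open Literature.NumberTheory.LFunctions.Hinkkanen1997 in
/-- `B₁₂/24 = −691/65520`. [cite: Serre1973, Ch. VII §4.1 (table of `B_k`: `B₁₂ = −691/2730`)] -/
theorem bernoulliRatio_twelve : bernoulliRatio 12 = -691 / 65520 := by
  rw [bernoulliRatio, bernoulli_eq_bernoulli'_of_ne_one (by norm_num), bernoulli'_12]; norm_num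

open Literature.NumberTheory.LFunctions.Hinkkanen1997 in
/-- `−24/B₁₂ = 65520/691` (`E₁₂ = 1 + (65520/691)Σσ₁₁(n)qⁿ`). [cite: Serre1973, Ch. VII §4.1 (34)]
[cite: DatskovskyGuerzhoy1996, p. 2287 (the coefficient `65520/691`)] -/
theorem neg_two_mul_div_bernoulli_twelve : -(2 * (12 : ℕ) / bernoulli 12 : ℂ) = ((65520 / 691 : ℚ) : ℂ) := by
  rw [bernoulli_eq_bernoulli'_of_ne_one (by norm_num), bernoulli'_12]; push_cast; norm_num

/-- `τ(2) = −24`. [cite: Serre1973, Ch. VII §4.5 (numerical table)] -/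
theorem ramanujanTau_two : ramanujanTau 2 = -24 := by
  rw [ramanujanTau, show (2 : ℕ) = 1 + 1 from rfl, PowerSeries.coeff_succ_X_mul,
    Literature.NumberTheory.EllipticCurves.coeff_one_formalDeltaUnit]

/-! ## §2 `ΔE₁₂ ∈ S₂₄` and `ΔE₁₂ = ΔE₄³ − (432000/691)Δ²` -/

/-- `Δ·E₁₂` as a cusp form of weight `24`. [cite: DatskovskyGuerzhoy1996, p. 2287 (the sums `Σ τ(a)(…σ₁₁(b))`)] -/
def deltaE₁₂ : CuspForm 𝒮ℒ 24 :=
  deltaMulE (m := 12) (by norm_num)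

/-- The coefficients of `ΔE₁₂` (Cauchy product). [cite: DatskovskyGuerzhoy1996, p. 2287] -/
theorem coeff_deltaE₁₂_eq_sum (n : ℕ) :
    (qExpansion 1 ⇑deltaE₁₂).coeff n =
      ∑ j ∈ Finset.range (n + 1), (ramanujanTau (n - j) : ℂ) *
        (if j = 0 then 1 else -(2 * (12 : ℕ) / bernoulli 12 : ℂ) * (sigma (12 - 1) j : ℂ)) :=
  qExpansion_coeff_deltaMulE (m := 12) (by norm_num) ⟨6, rfl⟩ n

/-- The same sum indexed by `a = n − j` and with DG's `σ₁₁(0)`-convention: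
`[qⁿ]ΔE₁₂ = Σ_{a=0}^{n} τ(a)·(65520/691)σ₁₁(n−a)`. [cite: DatskovskyGuerzhoy1996, p. 2287] -/
theorem coeff_deltaE₁₂_eq_sum' (n : ℕ) :
    (qExpansion 1 ⇑deltaE₁₂).coeff n =
      ∑ a ∈ Finset.range (n + 1), (ramanujanTau a : ℂ) *
        (((65520 / 691 : ℚ) : ℂ) * ((levelOneEisensteinGCoeff 12 (n - a) : ℚ) : ℂ)) := by
  rw [coeff_deltaE₁₂_eq_sum, ← Finset.sum_range_reflect]
  refine Finset.sum_congr rfl fun a ha => ?_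
  have ha' : a ≤ n := by simpa [Finset.mem_range, Nat.lt_succ_iff] using ha
  rw [show n + 1 - 1 - a = n - a from by omega, Nat.sub_sub_self ha', neg_two_mul_div_bernoulli_twelve,
    levelOneEisensteinGCoeff]
  congr 1
  split_ifs with h0
  · rw [bernoulliRatio_twelve]; push_cast; norm_num
  · push_cast; rfl

/-- `a₁(ΔE₁₂) = 1`. [cite: DatskovskyGuerzhoy1996, p. 2287] -/
theorem coeff_one_deltaE₁₂ : (qExpansion 1 ⇑deltaE₁₂).coeff 1 = 1 :=
  qExpansion_coeff_one_deltaMulE (m := 12) (by norm_num) ⟨6, rfl⟩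

/-- `a₂(ΔE₁₂) = τ(2) + 65520/691 = −24 + 65520/691`. [cite: DatskovskyGuerzhoy1996, p. 2287] -/
theorem coeff_two_deltaE₁₂ : (qExpansion 1 ⇑deltaE₁₂).coeff 2 = ((-24 + 65520 / 691 : ℚ) : ℂ) := by
  rw [coeff_deltaE₁₂_eq_sum' 2]
  simp only [Finset.sum_range_succ, Finset.sum_range_zero, zero_add, ramanujanTau_zero, ramanujanTau_one,
    ramanujanTau_two, Nat.sub_zero, Nat.sub_self, show 2 - 1 = 1 from rfl, levelOneEisensteinGCoeff_zero,
    levelOneEisensteinGCoeff_of_pos 12 one_pos, bernoulliRatio_twelve, show 12 - 1 = 11 from rfl, sigma_one]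
  push_cast
  ring

/-- **`ΔE₁₂ = ΔE₄³ − (432000/691)Δ²`** in `S₂₄` (both sides have `a₁ = 1`, `a₂ = −24 + 65520/691`).
[cite: Zagier2008, §4.1 (`S₂₄ = ⟨ΔE₄³, Δ²⟩`)] [cite: DatskovskyGuerzhoy1996, p. 2287 (`324204/691 = 432000/691 − 156`)] -/
theorem deltaE₁₂_eq_smul_g₁_add_smul_g₂ : deltaE₁₂ = (1 : ℂ) • g₁ + ((-432000 / 691 : ℚ) : ℂ) • g₂ := by
  have h := eq_smul_g₁_add_smul_g₂ deltaE₁₂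
  rw [coeff_one_deltaE₁₂, coeff_two_deltaE₁₂] at h
  rw [h]
  congr 2
  push_cast
  ring

/-- `[qⁿ]ΔE₁₂ = c_n − (432000/691)d_n`. [cite: DatskovskyGuerzhoy1996, p. 2287] -/
theorem coeff_deltaE₁₂ (n : ℕ) :
    (qExpansion 1 ⇑deltaE₁₂).coeff n = (c n : ℂ) + ((-432000 / 691 : ℚ) : ℂ) * (d n : ℂ) := by
  rw [deltaE₁₂_eq_smul_g₁_add_smul_g₂, coeff_smul_g₁_add_smul_g₂_apply, one_mul, c_spec, d_spec]

/-- `[qⁿ]Δ² = Σ_{a=0}^{n} τ(a)τ(n−a)`. [cite: Zagier2008, §4.1 (`Δ² = q² − 48q³ + …`)] -/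
theorem d_eq_sum_ramanujanTau (n : ℕ) :
    (d n : ℂ) = ∑ a ∈ Finset.range (n + 1), (ramanujanTau a : ℂ) * (ramanujanTau (n - a) : ℂ) := by
  have hsq : qExpansion 1 ⇑G₂ = qExpansion 1 ModularForm.discriminant * qExpansion 1 ModularForm.discriminant := by
    rw [qExpansion_G₂, qExpansion_discriminant_eq_X_mul_deltaUnit]; ring
  rw [d_spec, hsq, PowerSeries.coeff_mul, Finset.Nat.sum_antidiagonal_eq_sum_range_succ_mk]
  simp only [coeff_qExpansion_discriminant_eq_ramanujanTau]

/-! ## §3 The printed sums -/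

/-- DG's elementary expression `Σ_{n=a+b, a,b≥0} τ(a)(τ(b)·lam + (65520/691)σ₁₁(b))` (with `σ₁₁(0) := −B₁₂/24`).
[cite: DatskovskyGuerzhoy1996, p. 2287] -/
def elementarySum (lam : ℚ) (n : ℕ) : ℚ :=
  ∑ a ∈ Finset.range (n + 1), (ramanujanTau a : ℚ) *
    ((ramanujanTau (n - a) : ℚ) * lam + 65520 / 691 * levelOneEisensteinGCoeff 12 (n - a))

/-- Unfolding lemma. [cite: DatskovskyGuerzhoy1996, p. 2287] -/
theorem elementarySum_def (lam : ℚ) (n : ℕ) :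
    elementarySum lam n = ∑ a ∈ Finset.range (n + 1), (ramanujanTau a : ℚ) *
      ((ramanujanTau (n - a) : ℚ) * lam + 65520 / 691 * levelOneEisensteinGCoeff 12 (n - a)) :=
  rfl

/-- **The printed sum is `[qⁿ](ΔE₁₂ + lam·Δ²) = c_n + (lam − 432000/691)·d_n`.** [cite: DatskovskyGuerzhoy1996, p. 2287] -/
theorem elementarySum_eq (lam : ℚ) (n : ℕ) : elementarySum lam n = c n + (lam - 432000 / 691) * d n := by
  have hC : ((elementarySum lam n : ℚ) : ℂ) = ((c n + (lam - 432000 / 691) * d n : ℚ) : ℂ) := by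
    have h1 := d_eq_sum_ramanujanTau n
    have h2 := coeff_deltaE₁₂_eq_sum' n
    have h3 := coeff_deltaE₁₂ n
    rw [elementarySum_def]
    push_cast at h2 h3 ⊢
    simp_rw [mul_add, Finset.sum_add_distrib]
    rw [← h2, h3]
    have h4 : ∑ a ∈ Finset.range (n + 1), (ramanujanTau a : ℂ) * ((ramanujanTau (n - a) : ℂ) * (lam : ℂ)) =
        (lam : ℂ) * (d n : ℂ) := by
      rw [h1, Finset.mul_sum]
      exact Finset.sum_congr rfl fun a _ => by ring
    rw [h4]
    ring
  exact_mod_cast hC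

/-- ★ **`Σ_{n=a+b, a,b≥0} τ(a)(τ(b)(324204/691 + 264) + (65520/691)σ₁₁(b)) ≡ σ₂₃(n) (mod 103)`** for every `n ≥ 0`
(`σ₁₁(0) = −B₁₂/24`, `σ₂₃(0) = −B₂₄/48`; congruence in `ℤ_{(103)}`). [cite: DatskovskyGuerzhoy1996, p. 2287 (first
display)] -/
theorem ratCongr_elementarySum_oneHundredThree (n : ℕ) :
    RatCongr 103 (elementarySum (324204 / 691 + 264) n) (levelOneEisensteinGCoeff 24 n) := by
  rcases Nat.eq_zero_or_pos n with rfl | hn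
  · rw [elementarySum_def, zero_add, Finset.sum_range_one, ramanujanTau_zero, Int.cast_zero, zero_mul,
      levelOneEisensteinGCoeff_zero, bernoulliRatio_twentyFour]
    exact ⟨131040, by decide, -2294797, by push_cast; norm_num⟩
  · rw [elementarySum_eq, levelOneEisensteinGCoeff_of_pos _ hn,
      show (c n : ℚ) + (324204 / 691 + 264 - 432000 / 691) * (d n : ℚ) = ((c n + 108 * d n : ℤ) : ℚ) by
        push_cast; ring,
      show ((sigma (24 - 1) n : ℕ) : ℚ) = (((sigma 23 n : ℕ) : ℤ) : ℚ) by norm_num, ratCongr_intCast_iff,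
      show c n + 108 * d n - ((sigma 23 n : ℕ) : ℤ) = (c n + 5 * d n - sigma 23 n) + 103 * d n by ring]
    exact dvd_add (dvd_c_add_five_mul_d_sub_sigma hn) (dvd_mul_right _ _)

/-- ★ **`Σ_{n=a+b, a,b≥0} τ(a)(τ(b)(324204/691 − 791119) + (65520/691)σ₁₁(b)) ≡ σ₂₃(n) (mod 2294797)`** for every
`n ≥ 0`. [cite: DatskovskyGuerzhoy1996, p. 2287 (second display)] -/
theorem ratCongr_elementarySum_twoMillion (n : ℕ) :
    RatCongr 2294797 (elementarySum (324204 / 691 - 791119) n) (levelOneEisensteinGCoeff 24 n) := by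
  rcases Nat.eq_zero_or_pos n with rfl | hn
  · rw [elementarySum_def, zero_add, Finset.sum_range_one, ramanujanTau_zero, Int.cast_zero, zero_mul,
      levelOneEisensteinGCoeff_zero, bernoulliRatio_twentyFour]
    exact ⟨131040, by decide, -103, by push_cast; norm_num⟩
  · rw [elementarySum_eq, levelOneEisensteinGCoeff_of_pos _ hn,
      show (c n : ℚ) + (324204 / 691 - 791119 - 432000 / 691) * (d n : ℚ) = ((c n + -791275 * d n : ℤ) : ℚ) by
        push_cast; ring,
      show ((sigma (24 - 1) n : ℕ) : ℚ) = (((sigma 23 n : ℕ) : ℤ) : ℚ) by norm_num, ratCongr_intCast_iff,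
      show c n + -791275 * d n - ((sigma 23 n : ℕ) : ℤ) = (c n + 1503522 * d n - sigma 23 n) - 2294797 * d n by ring]
    exact dvd_sub (dvd_c_add_mul_d_sub_sigma' hn) (dvd_mul_right _ _)

/-- The two printed sums, written out (the `def` unfolded), for `n ≥ 1` where `σ₂₃(n)` is the honest divisor sum.
[cite: DatskovskyGuerzhoy1996, p. 2287] -/
theorem ratCongr_sum_oneHundredThree {n : ℕ} (hn : 0 < n) :
    RatCongr 103 (∑ a ∈ Finset.range (n + 1), (ramanujanTau a : ℚ) *
      ((ramanujanTau (n - a) : ℚ) * (324204 / 691 + 264) + 65520 / 691 * levelOneEisensteinGCoeff 12 (n - a))) (sigma 23 n) := by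
  have h := ratCongr_elementarySum_oneHundredThree n
  rwa [levelOneEisensteinGCoeff_of_pos _ hn, elementarySum_def] at h

/-- Second printed sum, written out, for `n ≥ 1`. [cite: DatskovskyGuerzhoy1996, p. 2287] -/
theorem ratCongr_sum_twoMillion {n : ℕ} (hn : 0 < n) :
    RatCongr 2294797 (∑ a ∈ Finset.range (n + 1), (ramanujanTau a : ℚ) *
      ((ramanujanTau (n - a) : ℚ) * (324204 / 691 - 791119) + 65520 / 691 * levelOneEisensteinGCoeff 12 (n - a))) (sigma 23 n) := by
  have h := ratCongr_elementarySum_twoMillion n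
  rwa [levelOneEisensteinGCoeff_of_pos _ hn, elementarySum_def] at h

end WeightTwentyFour

end Literature.NumberTheory.ModularForms
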